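import Literature.MathematicalPhysics.QuantumManyBody.PeriodicFormSpectrum
import Literature.MathematicalPhysics.QuantumManyBody.BoseGasThermodynamicLimitRuelle
import Literature.Analysis.FunctionSpaces.HaarTorusBoundedTrigApprox
import HarnessLib

/-!
# The periodic `C¹` core in momentum space: energies as maximal-form energies, trigonometric polynomials

Topic `Literature/MathematicalPhysics/QuantumManyBody`, sequel of `PeriodicFormDomain.lean` /
`PeriodicFormSpectrum.lean` (form domain of the periodic `N`-body Hamiltonian on `(ℝ³/Lℤ³)^N`,
written for the maximal-form bound of the truncation argument `E₀(min(v,n)) ↑ E₀(v)`,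
[Simon, J. Operator Theory 1 (1979) 37; ReedSimonIV1978, Thm XIII.64]). Everything here is proved; no
definitions, no named facts.

The **maximal form** of a potential `w` on a class `η ∈ L²((ℝ/ℤ)^{3N})` (Haar probability measure,
Mathlib's `AddCircleMulti` convention) is, in the notation of the truncation files,

  `Q_w(η) = ∑ₙ (∑ₚ (2πnₚ/L)²) |⟪eₙ, η⟫|² + ∫ (W_w ∘ fromUnitTorusN L) |η|²`,  `W_w = periodicInteraction w L`

(spectral kinetic energy plus potential energy, values in `[0, ∞]`). This file supplies the two
facts about the core side of the statement "`Q_w` restricted to the embedded `C¹` core realises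
`periodicGroundStateEnergy`":

* `periodicEnergy_eq_maxForm` — for a periodic trial state `Ψ` and the embedding
  `ι(graphEmbed Ψ)` of `PeriodicFormDomain` (any auxiliary admissible `(v, hv, hW)`),
  `periodicEnergy w Ψ = Q_w(ι(graphEmbed Ψ))` [LSSY2005, (A.10) for the kinetic part]; the dictionary
  behind it (`coeFn_formEmbed_graphEmbed`, `inner_mFourierLp_formEmbed_graphEmbed`,
  `tsum_kinetic_formEmbed_graphEmbed`, `lintegral_pot_formEmbed_graphEmbed`) is stated for core
  functions rather than trial states;
* `periodicGroundStateEnergy_mul_le_maxForm_core` — **the core variational principle in torus form**: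
  `E₀(w) · ‖ιΨ‖² ≤ Q_w(ιΨ)` for every core function `Ψ` (normalise `Ψ`, or both sides vanish);
* `exists_core_formEmbed_eq_sum_smul` — **Bose-symmetric trigonometric polynomials are embedded core
  functions**: for a finite set of frequencies `S ⊆ ℤ^{3N}` stable under the particle permutations
  `n ↦ n ∘ (σ × id)` and coefficients `a` invariant under them, `∑_{n ∈ S} aₙ eₙ = ι(graphEmbed Ψ)` for
  the core function `Ψ = L^{-3N/2} ∑ aₙ e^{2πi n·X/L}`; hence
  `periodicGroundStateEnergy_mul_le_maxForm_sum_smul`: `E₀(w) ‖P‖² ≤ Q_w(P)` for such `P`.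

## References

* [ReedSimonIV1978] M. Reed, B. Simon, *Methods of Modern Mathematical Physics IV*, Thm. XIII.64.
* [LSSY2005] Lieb–Seiringer–Solovej–Yngvason, *The Mathematics of the Bose Gas and its
  Condensation* (2005), App. A, (A.10).
* B. Simon, *Maximal and minimal Schrödinger forms*, J. Operator Theory 1 (1979) 37–47.
-/

noncomputable section

open MeasureTheory Filter Set Complex UnitAddTorus
open scoped ENNReal NNReal Topology InnerProductSpace

namespace Literature.MathematicalPhysics.QuantumManyBody.BoseGas

-- The measure on `ℝ/ℤ` is the Haar PROBABILITY measure, as in `PeriodicFormDomain.lean`.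
attribute [local instance] formDomain_measureSpace formDomain_isProbabilityMeasure formDomain_isProbabilityMeasure_pi

variable {N : ℕ} {L : ℝ} {v : ℝ → ℝ≥0∞}

/-- Local notation for the Hilbert space `L²((ℝ/ℤ)^{3N})`, as in `PeriodicFormDomain.lean`. -/
local notation "L2T " N':max => Lp ℂ 2 (volume : Measure (UnitAddTorus (Fin N' × Fin 3)))

/-- The periodic interaction of a measurable profile is measurable (copy of the lemma of
`DiluteBoseGasUpperBoundLocalization.lean`, kept private to avoid that import). [folklore] -/
private theorem measurable_periodicInteraction_core (hv : Measurable v) (L : ℝ) :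
    Measurable (periodicInteraction (N := N) v L) := by
  unfold periodicInteraction periodizedPotential
  refine Finset.measurable_sum _ fun i _ => Finset.measurable_sum _ fun j _ => ?_
  exact (Measurable.tsum fun n => hv.comp (measurable_id.sub_const _).norm).comp
    ((measurable_config_apply i).sub (measurable_config_apply j))

/-! ### The dictionary for core functions -/

section Dictionary

variable (hL : 0 < L) (hv : Measurable v) (hW : ∫⁻ X in cellN N L, periodicInteraction v L X ≠ ⊤)

/-- The embedded class `ι(graphEmbed Ψ)` of a core function, as a function on the torus: a.e.
`L^{3N/2} Ψ ∘ fromUnitTorusN`. [folklore] -/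
theorem coeFn_formEmbed_graphEmbed (Ψ : periodicCore N L) :
    ∀ᵐ t ∂(volume : Measure (UnitAddTorus (Fin N × Fin 3))),
      (formEmbed hL hv hW ⟨graphEmbed hL hv hW Ψ, graphEmbed_mem_formDomain hL hv hW Ψ⟩ :
        UnitAddTorus (Fin N × Fin 3) → ℂ) t = (cellScale N L : ℂ) * (Ψ : Config N → ℂ) (fromUnitTorusN L t) := by
  have hΨ : ContDiff ℝ 1 (Ψ : Config N → ℂ) := Ψ.2.1
  have h := (Lp.coeFn_smul ((cellScale N L : ℝ) : ℂ)
    ((memLp_torusFunN_compFun hL hv hW hΨ (Sum.inl ())).toLp _)).and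
    (memLp_torusFunN_compFun hL hv hW hΨ (Sum.inl ())).coeFn_toLp
  filter_upwards [h] with t ht
  rw [formEmbed_apply]
  change (compLp hL hv hW hΨ (Sum.inl ()) : UnitAddTorus (Fin N × Fin 3) → ℂ) t = _
  unfold compLp
  rw [ht.1, Pi.smul_apply, ht.2]
  simp only [torusFunN, compFun_val, smul_eq_mul]

/-- The Fourier coefficients of the embedded class: `⟪eₙ, ι(graphEmbed Ψ)⟫ = L^{3N/2} ĉₙ(Ψ)`. [folklore] -/
theorem inner_mFourierLp_formEmbed_graphEmbed (Ψ : periodicCore N L) (n : Fin N × Fin 3 → ℤ) :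
    ⟪(mFourierLp 2 n : L2T N),
      formEmbed hL hv hW ⟨graphEmbed hL hv hW Ψ, graphEmbed_mem_formDomain hL hv hW Ψ⟩⟫_ℂ =
      (cellScale N L : ℂ) * configFourierCoeff L (Ψ : Config N → ℂ) n := by
  rw [formEmbed_apply]
  exact inner_mFourierLp_compLp_val hL hv hW Ψ.2.1 n

/-- **The spectral kinetic energy of the embedded class is the kinetic energy**:
`∑ₙ (2πn/L)² |⟪eₙ, ι(graphEmbed Ψ)⟫|² = ∫_{[0,L)^{3N}} |∇Ψ|²`. [cite: LSSY2005, App. A (A.10)] -/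
theorem tsum_kinetic_formEmbed_graphEmbed (Ψ : periodicCore N L) :
    ∑' n : Fin N × Fin 3 → ℤ, ENNReal.ofReal (∑ p, (2 * Real.pi * (n p : ℝ) / L) ^ 2) *
        (‖⟪(mFourierLp 2 n : L2T N),
          formEmbed hL hv hW ⟨graphEmbed hL hv hW Ψ, graphEmbed_mem_formDomain hL hv hW Ψ⟩⟫_ℂ‖₊ :
            ℝ≥0∞) ^ 2 =
      ∫⁻ X in cellN N L, kineticDensity (Ψ : Config N → ℂ) X := by
  have hsq : ∀ z : ℂ, ((‖(cellScale N L : ℂ) * z‖₊ : ℝ≥0∞)) ^ 2 =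
      ENNReal.ofReal (cellScale N L ^ 2) * (‖z‖₊ : ℝ≥0∞) ^ 2 := fun z => by
    rw [coe_nnnorm_sq_eq_ofReal, coe_nnnorm_sq_eq_ofReal, norm_mul, Complex.norm_real,
      Real.norm_of_nonneg (cellScale_nonneg N L), mul_pow, ENNReal.ofReal_mul (sq_nonneg _)]
  have hone : ENNReal.ofReal (cellScale N L ^ 2) * ((ENNReal.ofReal L ^ 3)⁻¹) ^ N = 1 := by
    rw [cellScale_sq hL.le, ← ofReal_inv_pow_three_pow hL N, ← ENNReal.ofReal_mul (by positivity),
      ← mul_pow, mul_inv_cancel₀ (pow_ne_zero 3 hL.ne'), one_pow, ENNReal.ofReal_one]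
  simp only [inner_mFourierLp_formEmbed_graphEmbed hL hv hW Ψ, hsq]
  simp only [mul_left_comm _ (ENNReal.ofReal (cellScale N L ^ 2))]
  rw [ENNReal.tsum_mul_left, tsum_sq_mul_sq_configFourierCoeff hL Ψ.2.1 Ψ.2.2.1, ← mul_assoc, hone,
    one_mul]

/-- **The potential energy of the embedded class** against any measurable weight transported to the
torus: `∫ (W ∘ fromUnitTorusN) |ι(graphEmbed Ψ)|² = ∫_{[0,L)^{3N}} W |Ψ|²`. [folklore] -/
theorem lintegral_pot_formEmbed_graphEmbed (Ψ : periodicCore N L) {W : Config N → ℝ≥0∞}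
    (hWm : Measurable W) :
    ∫⁻ t, W (fromUnitTorusN L t) *
        (‖(formEmbed hL hv hW ⟨graphEmbed hL hv hW Ψ, graphEmbed_mem_formDomain hL hv hW Ψ⟩ :
          UnitAddTorus (Fin N × Fin 3) → ℂ) t‖₊ : ℝ≥0∞) ^ 2 =
      ∫⁻ X in cellN N L, W X * (‖(Ψ : Config N → ℂ) X‖₊ : ℝ≥0∞) ^ 2 := by
  have hΨc : Continuous (Ψ : Config N → ℂ) := Ψ.2.1.continuous
  have hG : Measurable fun X : Config N => W X * (‖(Ψ : Config N → ℂ) X‖₊ : ℝ≥0∞) ^ 2 :=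
    hWm.mul ((hΨc.measurable.nnnorm.coe_nnreal_ennreal).pow_const 2)
  have hsq : ∀ z : ℂ, ((‖(cellScale N L : ℂ) * z‖₊ : ℝ≥0∞)) ^ 2 =
      ENNReal.ofReal (cellScale N L ^ 2) * (‖z‖₊ : ℝ≥0∞) ^ 2 := fun z => by
    rw [coe_nnnorm_sq_eq_ofReal, coe_nnnorm_sq_eq_ofReal, norm_mul, Complex.norm_real,
      Real.norm_of_nonneg (cellScale_nonneg N L), mul_pow, ENNReal.ofReal_mul (sq_nonneg _)]
  have hone : ENNReal.ofReal (cellScale N L ^ 2) * ((ENNReal.ofReal L ^ 3)⁻¹) ^ N = 1 := by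
    rw [cellScale_sq hL.le, ← ofReal_inv_pow_three_pow hL N, ← ENNReal.ofReal_mul (by positivity),
      ← mul_pow, mul_inv_cancel₀ (pow_ne_zero 3 hL.ne'), one_pow, ENNReal.ofReal_one]
  calc _ = ∫⁻ t, ENNReal.ofReal (cellScale N L ^ 2) *
        (W (fromUnitTorusN L t) * (‖(Ψ : Config N → ℂ) (fromUnitTorusN L t)‖₊ : ℝ≥0∞) ^ 2) := by
        refine lintegral_congr_ae ((coeFn_formEmbed_graphEmbed hL hv hW Ψ).mono fun t ht => ?_)
        dsimp only
        rw [ht, hsq]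
        ring
    _ = ENNReal.ofReal (cellScale N L ^ 2) * (((ENNReal.ofReal L ^ 3)⁻¹) ^ N *
          ∫⁻ X in cellN N L, W X * (‖(Ψ : Config N → ℂ) X‖₊ : ℝ≥0∞) ^ 2) := by
        rw [lintegral_const_mul' _ _ ENNReal.ofReal_ne_top, lintegral_fromUnitTorusN hL hG]
    _ = _ := by rw [← mul_assoc, hone, one_mul]

/-- **The energy of a trial state is the maximal-form energy of its embedded class**:
`periodicEnergy w Ψ = ∑ₙ (2πn/L)² |⟪eₙ, ιΨ⟫|² + ∫ (W_w ∘ fromUnitTorusN) |ιΨ|²` for every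
measurable profile `w` (the embedding `ι` may be built with any auxiliary admissible `v`).
[cite: LSSY2005, App. A (A.10)] -/
theorem periodicEnergy_eq_maxForm {w : ℝ → ℝ≥0∞} (hw : Measurable w) (Ψ : PeriodicTrialState N L) :
    periodicEnergy w Ψ =
      ∑' n : Fin N × Fin 3 → ℤ, ENNReal.ofReal (∑ p, (2 * Real.pi * (n p : ℝ) / L) ^ 2) *
          (‖⟪(mFourierLp 2 n : L2T N),
            formEmbed hL hv hW ⟨graphEmbed hL hv hW ⟨Ψ.ψ, Ψ.mem_periodicCore⟩,
              graphEmbed_mem_formDomain hL hv hW _⟩⟫_ℂ‖₊ : ℝ≥0∞) ^ 2 +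
        ∫⁻ t, periodicInteraction w L (fromUnitTorusN L t) *
          (‖(formEmbed hL hv hW ⟨graphEmbed hL hv hW ⟨Ψ.ψ, Ψ.mem_periodicCore⟩,
              graphEmbed_mem_formDomain hL hv hW _⟩ : UnitAddTorus (Fin N × Fin 3) → ℂ) t‖₊ : ℝ≥0∞) ^ 2 := by
  rw [tsum_kinetic_formEmbed_graphEmbed hL hv hW ⟨Ψ.ψ, Ψ.mem_periodicCore⟩,
    lintegral_pot_formEmbed_graphEmbed hL hv hW ⟨Ψ.ψ, Ψ.mem_periodicCore⟩
      (measurable_periodicInteraction_core hw L)]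
  unfold periodicEnergy
  rw [← lintegral_add_left (measurable_kineticDensity_any Ψ.ψ)]

end Dictionary

/-! ### The core variational principle in torus form -/

section Variational

variable (hL : 0 < L) (hv : Measurable v) (hW : ∫⁻ X in cellN N L, periodicInteraction v L X ≠ ⊤)

/-- Scaling of the spectral kinetic energy: `∑ₙ wₙ |⟪eₙ, c • η⟫|² = ofReal(‖c‖²) ∑ₙ wₙ |⟪eₙ, η⟫|²`.
[folklore] -/
theorem tsum_weight_inner_smul (w : (Fin N × Fin 3 → ℤ) → ℝ≥0∞) (c : ℂ) (η : L2T N) :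
    ∑' n : Fin N × Fin 3 → ℤ, w n * (‖⟪(mFourierLp 2 n : L2T N), c • η⟫_ℂ‖₊ : ℝ≥0∞) ^ 2 =
      ENNReal.ofReal (‖c‖ ^ 2) * ∑' n : Fin N × Fin 3 → ℤ, w n * (‖⟪(mFourierLp 2 n : L2T N), η⟫_ℂ‖₊ : ℝ≥0∞) ^ 2 := by
  rw [← ENNReal.tsum_mul_left]
  refine tsum_congr fun n => ?_
  rw [inner_smul_right, coe_nnnorm_sq_eq_ofReal, coe_nnnorm_sq_eq_ofReal, norm_mul, mul_pow,
    ENNReal.ofReal_mul (sq_nonneg _)]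
  ring

/-- Scaling of the potential energy: `∫ W |c • η|² = ofReal(‖c‖²) ∫ W |η|²`. [folklore] -/
theorem lintegral_weight_smul_sq (W : UnitAddTorus (Fin N × Fin 3) → ℝ≥0∞) (c : ℂ) (η : L2T N) :
    ∫⁻ t, W t * (‖((c • η : L2T N) : UnitAddTorus (Fin N × Fin 3) → ℂ) t‖₊ : ℝ≥0∞) ^ 2 =
      ENNReal.ofReal (‖c‖ ^ 2) * ∫⁻ t, W t * (‖(η : UnitAddTorus (Fin N × Fin 3) → ℂ) t‖₊ : ℝ≥0∞) ^ 2 := by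
  rw [← lintegral_const_mul' _ _ ENNReal.ofReal_ne_top]
  refine lintegral_congr_ae ((Lp.coeFn_smul c η).mono fun t ht => ?_)
  dsimp only
  rw [ht, Pi.smul_apply, smul_eq_mul, coe_nnnorm_sq_eq_ofReal, coe_nnnorm_sq_eq_ofReal, norm_mul, mul_pow,
    ENNReal.ofReal_mul (sq_nonneg _)]
  ring

/-- **The core variational principle in torus form.** For every core function `Ψ` (`C¹`, periodic,
Bose-symmetric) and every measurable profile `w`,
`E₀(w) · ‖ιΨ‖² ≤ ∑ₙ (2πn/L)² |⟪eₙ, ιΨ⟫|² + ∫ (W_w ∘ fromUnitTorusN) |ιΨ|²`, `ιΨ = ι(graphEmbed Ψ)`: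
either `ιΨ = 0`, or `Ψ/‖ιΨ‖` is a periodic trial state whose energy bounds `E₀(w)`.
[cite: ReedSimonIV1978, Thm. XIII.64] -/
theorem periodicGroundStateEnergy_mul_le_maxForm_core {w : ℝ → ℝ≥0∞} (hw : Measurable w)
    (Ψ : periodicCore N L) :
    periodicGroundStateEnergy w N L *
        ENNReal.ofReal (‖formEmbed hL hv hW ⟨graphEmbed hL hv hW Ψ, graphEmbed_mem_formDomain hL hv hW Ψ⟩‖ ^ 2) ≤
      ∑' n : Fin N × Fin 3 → ℤ, ENNReal.ofReal (∑ p, (2 * Real.pi * (n p : ℝ) / L) ^ 2) *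
          (‖⟪(mFourierLp 2 n : L2T N),
            formEmbed hL hv hW ⟨graphEmbed hL hv hW Ψ, graphEmbed_mem_formDomain hL hv hW Ψ⟩⟫_ℂ‖₊ : ℝ≥0∞) ^ 2 +
        ∫⁻ t, periodicInteraction w L (fromUnitTorusN L t) *
          (‖(formEmbed hL hv hW ⟨graphEmbed hL hv hW Ψ, graphEmbed_mem_formDomain hL hv hW Ψ⟩ :
              UnitAddTorus (Fin N × Fin 3) → ℂ) t‖₊ : ℝ≥0∞) ^ 2 := by
  set c : ℝ := ‖formEmbed hL hv hW ⟨graphEmbed hL hv hW Ψ, graphEmbed_mem_formDomain hL hv hW Ψ⟩‖ with hc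
  rcases eq_or_lt_of_le (show 0 ≤ c from norm_nonneg _) with h0 | hpos
  · rw [← h0]
    simp
  -- normalise
  set Φ : periodicCore N L := ((c⁻¹ : ℝ) : ℂ) • Ψ with hΦ
  have hιΦ : formEmbed hL hv hW ⟨graphEmbed hL hv hW Φ, graphEmbed_mem_formDomain hL hv hW Φ⟩ =
      ((c⁻¹ : ℝ) : ℂ) • formEmbed hL hv hW ⟨graphEmbed hL hv hW Ψ, graphEmbed_mem_formDomain hL hv hW Ψ⟩ := by
    rw [← map_smul]
    congr 1
    apply Subtype.ext
    simp only [hΦ, map_smul, SetLike.mk_smul_mk]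
  have h1 : ‖formEmbed hL hv hW ⟨graphEmbed hL hv hW Φ, graphEmbed_mem_formDomain hL hv hW Φ⟩‖ = 1 := by
    rw [hιΦ, norm_smul, Complex.norm_real, Real.norm_of_nonneg (inv_nonneg.2 hpos.le), ← hc,
      inv_mul_cancel₀ hpos.ne']
  have hE := periodicGroundStateEnergy_le w (PeriodicTrialState.ofCore hL hv hW Φ h1)
  rw [periodicEnergy_eq_maxForm hL hv hW hw] at hE
  have hcore : (⟨(PeriodicTrialState.ofCore hL hv hW Φ h1).ψ,
      (PeriodicTrialState.ofCore hL hv hW Φ h1).mem_periodicCore⟩ : periodicCore N L) = Φ := rfl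
  rw [hcore, hιΦ, tsum_weight_inner_smul, lintegral_weight_smul_sq, ← mul_add, Complex.norm_real,
    Real.norm_of_nonneg (inv_nonneg.2 hpos.le)] at hE
  -- multiply through by `c²`
  have hcc : ENNReal.ofReal (c ^ 2) * ENNReal.ofReal (c⁻¹ ^ 2) = 1 := by
    rw [← ENNReal.ofReal_mul (sq_nonneg _), ← mul_pow, mul_inv_cancel₀ hpos.ne', one_pow, ENNReal.ofReal_one]
  calc periodicGroundStateEnergy w N L * ENNReal.ofReal (c ^ 2)
      ≤ (ENNReal.ofReal (c⁻¹ ^ 2) * _) * ENNReal.ofReal (c ^ 2) := mul_le_mul_left hE _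
    _ = _ := by rw [mul_comm, ← mul_assoc, hcc, one_mul]

end Variational

/-! ### Bose-symmetric trigonometric polynomials are embedded core functions -/

section TrigPoly

variable (hL : 0 < L) (hv : Measurable v) (hW : ∫⁻ X in cellN N L, periodicInteraction v L X ≠ ⊤)

/-- The `N`-body plane wave factorises over the particles: `e_n(X) = ∏ᵢ e_{n(i,·)}(xᵢ)`. [folklore] -/
theorem cellWaveN_eq_prod (L : ℝ) (n : Fin N × Fin 3 → ℤ) (X : Config N) :
    cellWaveN L n X = ∏ i : Fin N, cellWave L (fun k => n (i, k)) (X i) := by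
  unfold cellWaveN cellWave mFourier
  simp only [ContinuousMap.coe_mk]
  rw [Fintype.prod_prod_type]
  rfl

/-- The `N`-body plane waves are smooth. [folklore] -/
theorem contDiff_cellWaveN (L : ℝ) (n : Fin N × Fin 3 → ℤ) : ContDiff ℝ 1 (cellWaveN (N := N) L n) := by
  have h : cellWaveN (N := N) L n = fun X => ∏ i : Fin N, cellWave L (fun k => n (i, k)) (X i) :=
    funext (cellWaveN_eq_prod L n)
  rw [h]
  exact contDiff_prod fun i _ => ((contDiff_cellWave L _).of_le (mod_cast le_top)).comp (contDiff_apply ℝ Space i)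

/-- Permuting the particles of a configuration permutes the torus coordinates. [folklore] -/
theorem toUnitTorusN_comp_perm (L : ℝ) (σ : Equiv.Perm (Fin N)) (X : Config N) :
    toUnitTorusN L (X ∘ σ) = fun p : Fin N × Fin 3 => toUnitTorusN L X (σ p.1, p.2) := rfl

/-- Bose symmetry of an `N`-body trigonometric polynomial with symmetric frequency set and
coefficients. [folklore] -/
theorem sum_mul_cellWaveN_comp_perm {S : Finset (Fin N × Fin 3 → ℤ)} {a : (Fin N × Fin 3 → ℤ) → ℂ}
    (hS : ∀ (σ : Equiv.Perm (Fin N)) (n : Fin N × Fin 3 → ℤ), n ∈ S → (fun p => n (σ p.1, p.2)) ∈ S)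
    (ha : ∀ (σ : Equiv.Perm (Fin N)) (n : Fin N × Fin 3 → ℤ), a (fun p => n (σ p.1, p.2)) = a n)
    (σ : Equiv.Perm (Fin N)) (X : Config N) :
    ∑ n ∈ S, a n * cellWaveN L n (X ∘ σ) = ∑ n ∈ S, a n * cellWaveN L n X := by
  unfold cellWaveN
  rw [toUnitTorusN_comp_perm]
  -- `e_n(t ∘ (σ × id)) = e_{n ∘ (σ⁻¹ × id)}(t)` and reindex the sum by `n ↦ n ∘ (σ⁻¹ × id)`
  have hchar : ∀ n : Fin N × Fin 3 → ℤ, mFourier n (fun p : Fin N × Fin 3 => toUnitTorusN L X (σ p.1, p.2)) =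
      mFourier (fun p : Fin N × Fin 3 => n (σ.symm p.1, p.2)) (toUnitTorusN L X) := fun n =>
    Literature.Analysis.FunctionSpaces.HaarTorus.mFourier_comp_perm n (Equiv.prodCongr σ (Equiv.refl (Fin 3))) _
  simp only [hchar]
  refine Finset.sum_nbij' (fun n p => n (σ.symm p.1, p.2)) (fun n p => n (σ p.1, p.2)) ?_ ?_ ?_ ?_ ?_
  · intro n hn; exact hS σ.symm n hn
  · intro n hn; exact hS σ n hn
  · intro n _; funext p; simp
  · intro n _; funext p; simp
  · intro n _
    rw [← ha σ.symm n]

/-- **Bose-symmetric trigonometric polynomials are embedded core functions.** For a finite set of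
frequencies `S` stable under the particle permutations and coefficients `a` invariant under them,
the core function `Ψ = L^{-3N/2} ∑_{n ∈ S} aₙ e^{2πi n·X/L}` has `ι(graphEmbed Ψ) = ∑_{n ∈ S} aₙ eₙ`
in `L²((ℝ/ℤ)^{3N})`. [folklore] -/
theorem exists_core_formEmbed_eq_sum_smul {S : Finset (Fin N × Fin 3 → ℤ)} {a : (Fin N × Fin 3 → ℤ) → ℂ}
    (hS : ∀ (σ : Equiv.Perm (Fin N)) (n : Fin N × Fin 3 → ℤ), n ∈ S → (fun p => n (σ p.1, p.2)) ∈ S)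
    (ha : ∀ (σ : Equiv.Perm (Fin N)) (n : Fin N × Fin 3 → ℤ), a (fun p => n (σ p.1, p.2)) = a n) :
    ∃ Ψ : periodicCore N L,
      formEmbed hL hv hW ⟨graphEmbed hL hv hW Ψ, graphEmbed_mem_formDomain hL hv hW Ψ⟩ =
        ∑ n ∈ S, a n • (mFourierLp 2 n : L2T N) := by
  set P : Config N → ℂ := fun X => ((cellScale N L)⁻¹ : ℂ) * ∑ n ∈ S, a n * cellWaveN L n X with hP
  have hPmem : P ∈ periodicCore N L := by
    refine ⟨?_, ?_, ?_⟩
    · exact contDiff_const.mul (ContDiff.sum fun n _ => contDiff_const.mul (contDiff_cellWaveN L n))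
    · intro X i k
      simp only [hP, cellWaveN_periodic hL.ne' _ X i k]
    · intro σ X
      simp only [hP, sum_mul_cellWaveN_comp_perm hS ha σ X]
  refine ⟨⟨P, hPmem⟩, Lp.ext ?_⟩
  have hsc : cellScale N L ≠ 0 := by
    rw [cellScale]; exact (Real.sqrt_pos.2 (by positivity)).ne'
  filter_upwards [coeFn_formEmbed_graphEmbed hL hv hW ⟨P, hPmem⟩,
    Literature.Analysis.FunctionSpaces.HaarTorus.coeFn_sum_smul_mFourierLp S a] with t h1 h2
  rw [h1, h2]
  simp only [hP, cellWaveN, toUnitTorusN_fromUnitTorusN hL.ne', ← mul_assoc]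
  rw [mul_inv_cancel₀ (by exact_mod_cast hsc), one_mul]

omit hv hW in
/-- **The core variational principle for Bose-symmetric trigonometric polynomials**: for `L > 0`,
`S`, `a` as above and every measurable profile `w`, with `P = ∑_{n ∈ S} aₙ eₙ`,
`E₀(w) · ‖P‖² ≤ ∑ₙ (2πn/L)² |⟪eₙ, P⟫|² + ∫ (W_w ∘ fromUnitTorusN) |P|²` (the embedding is built
with the free profile `v = 0`). [cite: ReedSimonIV1978, Thm. XIII.64] -/
theorem periodicGroundStateEnergy_mul_le_maxForm_sum_smul (hL : 0 < L) {w : ℝ → ℝ≥0∞} (hw : Measurable w)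
    {S : Finset (Fin N × Fin 3 → ℤ)} {a : (Fin N × Fin 3 → ℤ) → ℂ}
    (hS : ∀ (σ : Equiv.Perm (Fin N)) (n : Fin N × Fin 3 → ℤ), n ∈ S → (fun p => n (σ p.1, p.2)) ∈ S)
    (ha : ∀ (σ : Equiv.Perm (Fin N)) (n : Fin N × Fin 3 → ℤ), a (fun p => n (σ p.1, p.2)) = a n) :
    periodicGroundStateEnergy w N L * ENNReal.ofReal (‖∑ n ∈ S, a n • (mFourierLp 2 n : L2T N)‖ ^ 2) ≤
      ∑' n : Fin N × Fin 3 → ℤ, ENNReal.ofReal (∑ p, (2 * Real.pi * (n p : ℝ) / L) ^ 2) *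
          (‖⟪(mFourierLp 2 n : L2T N), ∑ m ∈ S, a m • (mFourierLp 2 m : L2T N)⟫_ℂ‖₊ : ℝ≥0∞) ^ 2 +
        ∫⁻ t, periodicInteraction w L (fromUnitTorusN L t) *
          (‖((∑ m ∈ S, a m • (mFourierLp 2 m : L2T N) : L2T N) : UnitAddTorus (Fin N × Fin 3) → ℂ) t‖₊ :
            ℝ≥0∞) ^ 2 := by
  have hv0 : Measurable (0 : ℝ → ℝ≥0∞) := measurable_const
  have hW0 : ∫⁻ X in cellN N L, periodicInteraction (0 : ℝ → ℝ≥0∞) L X ≠ ⊤ := by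
    simp [periodicInteraction, periodizedPotential]
  obtain ⟨Ψ, hΨ⟩ := exists_core_formEmbed_eq_sum_smul hL hv0 hW0 hS ha
  rw [← hΨ]
  exact periodicGroundStateEnergy_mul_le_maxForm_core hL hv0 hW0 hw Ψ

end TrigPoly

end Literature.MathematicalPhysics.QuantumManyBody.BoseGas

end
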